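import Literature.Computability.Cryptography.RegevSamplerSubstLaw
import Literature.Computability.Cryptography.RegevSamplerGRLabel
import Literature.Computability.Cryptography.RegevSamplerQFT
import Literature.Computability.Cryptography.RegevSamplerData
import Literature.Computability.Cryptography.RegevSamplerOutLaw
import Literature.Computability.Cryptography.RegevSamplerStageCircuit
import Literature.Computability.QuantumComplexity.StageCircuitsOracleFree
import HarnessLib

/-!
# Regev 2009, Lemma 3.14 in machine form: the measured law of the sampler machine

Topic `Computability/Cryptography` (family `pqc`), grouping namespace `Regev2009.SamplerRegs`. This file
ASSEMBLES the analysis of Regev's quantum sampler (J. ACM 56 (2009), art. 34; author's version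
arXiv:2401.03703, Lemma 3.14, p. 20, run with the `CVP` procedure in place of the oracle as in the proof
of Lemma 3.3, p. 15) for the explicit machine on the sampler's register layout `Λ`:

  `M = (Fourier stage on the residue blocks) · (classical stage O·C_X·O·C_S·C_Y with the placed tidy`
  `block of the CVP family R in both oracle slots) · (NOT layer) · (Grover–Rudolph stage)`

applied to the prepared basis state. **`law_bound_machine`**: for every event `A ⊆ ℝⁿ`, the probability
that the decoded residue read-out lies in `A` is within

  `2(n(ℓ·grErr k + η) + 4√(wf + (2C)²) + n ℓ_R² qftPhaseErr k_F + 8C) + 2(√(2(δ_Y + c_Bⁿ + 4⁻ⁿ)) + 2·2⁻ⁿ) + 9·2⁻ⁿ`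

of `D_{L_t, 1/√2}(A)` (`L_t = t⁻¹ L(B)`), where `wf` is the failure probability of `R` averaged over the
Gaussian weights of the admissible box points (`CVPOracle.weightedFail`) and `η` the Grover–Rudolph
blocks' own angle error. Every analytic hypothesis of the substitution bound
`SamplerSubst.law_bound_sampler_of_short` is DISCHARGED from the tree: the fibre hypotheses
(`SamplerGeom.fibreHyps_T`), the register hypotheses (`SamplerRegs.regHyps`), the query format
(`SamplerRegs.ofFn_qry_kappa_lab₀_of_mem`, `inRange_cOf`, `le_length_answerTable_cOf`, `admissible_cOf`),
the lattice conditions (`SamplerScale.eq_zero_of_mem_scaledLattice_dualOver_scaledL`,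
`eq_zero_of_mem_scaledL_of_norm_smul_lt`), the decoder (`SamplerDecode.dec_eq_of_norm_lt`), the box
geometry (`boxCoversShort_T`, `norm_yOfB_le_T`, `norm_sub_yOfB_le_T`), the Gaussian stage
(`l2Norm_notLayer_grStage_sub_embed_le`) and the Fourier stage (`qftStage_implOn_Sblk`,
`kappa_lab₀_mem_P_qftBlock`). What remains as hypotheses are Regev's parameter conditions
(`√n/t ≤ λ₁(L*)/2`, `2√n ≤ t λ₁(L*)`, `2√n t ≤ R λ₁(L)`, the decoder's `2 t √n ‖b∨ⱼ‖ ≤ R`, the box fit,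
the widths `ℓ_Y, b_c`, the constants `δ_Y < 1`, `C`), the prefix of the input zone, the subroutine's zone in
the work window, and the Grover–Rudolph data (`GRBlock.Data`, the base content `x₀ ∈ P`, the erasing list).

* `Ysz`, `Bsz` — the size data `Y = t R⁻¹ Σ‖b∨ᵢ‖`, `B = √n 2^ℓ/D_t + Y` of the box;
* `dec_scaledL` — the decoder hypothesis of `QPart.law_bound_of_basis` for `L_t` from `dec_eq_of_norm_lt`;
* `l2Norm_grState` — the Gaussian stage's output is a unit vector;
* **`law_bound_machine`**;
* `toReal_bornPMF_setOf` (the Born law of a unit vector on an event is the filtered sum of squared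
  amplitudes), **`tvDist_machine`** — the same bound for the statistical distance between the law of the
  integer output `decZ ∘ readS` under the Born distribution of the machine's final state and
  `intCoords_* D_{L(B), t/√2}` (the form of `regev2009_lemma_3_14_stepFamily`'s middle clause, via
  `SamplerDecode.tvDist_map_decZ_le`);
* `machineCirc`, `runOn_machineCirc`, **`tvDist_machineCirc`** — the same machine as ONE circuit (GR stage,
  NOT layer, `RegevSamplerStageCircuit.stageCirc` with the tidy `CVP` blocks, QFT stage) and the bound for
  the law of its output state `machineCirc.runOn 0 |label⟩`.
* `slack`, **`tvDist_machineCirc_le`** — the same bound in the shape `8·√(weighted failure) + slack n ℓ ℓ_R k k_F Y C η`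
  of the middle clause of `regev2009_lemma_3_14_stepFamily` (the slack is what the parameter choice must make
  negligible).
* `notLayer_isOracleFree`, **`isOracleFree_machineCirc`** — the machine circuit contains no oracle gate
  (`QuantumComplexity/StageCircuitsOracleFree.lean`, `isOracleFree_stageCirc`, `tidyCirc_isOracleFree`).

Everything is proved; definitions have bodies; no named fact is introduced. (The uniform-family dressing
of `regev2009_lemma_3_14_stepFamily` — the machine as a `UniformQCircuitFamily`, its kernel, the
parameters as functions of the instance — is not in this file.)

## References

* O. Regev, *On lattices, learning with errors, random linear codes, and cryptography*, J. ACM 56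
  (2009), art. 34; author's version arXiv:2401.03703: Lemma 3.14 (proof, p. 20), Lemma 3.3 (proof,
  p. 15), Lemma 3.12, Claim 2.9 [Regev2009].
* C. H. Bennett, E. Bernstein, G. Brassard, U. Vazirani, *Strengths and weaknesses of quantum
  computing*, SIAM J. Comput. 26 (1997) 1510–1523, Thm. 3.3, Thm. 4.14 [BennettBernsteinBrassardVazirani1997].
* L. Grover, T. Rudolph, *Creating superpositions that correspond to efficiently integrable probability
  distributions*, arXiv:quant-ph/0208112 (2002), eq. (1) [GroverRudolph2002].
* M. A. Nielsen, I. L. Chuang, *Quantum Computation and Quantum Information*, CUP 2010, §5.1, Box 4.1,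
  §3.2.5 [NielsenChuang2010].
-/

noncomputable section

namespace Literature.Computability.Cryptography

namespace Regev2009

namespace SamplerRegs

open Literature.Algebra.EuclideanLattices Literature.Algebra.EuclideanLattices.Regev2009
  Literature.Algebra.EuclideanLattices.Regev2009.QPart Literature.Computability.QuantumComplexity
  Literature.Computability.QuantumComplexity.GaussianCells Literature.Computability.QuantumComplexity.GroverRudolph
  Literature.Computability.QuantumComplexity.GRWord Literature.Computability.QuantumComplexity.QFTQubits
  Literature.Computability.QuantumComplexity.QFTWord Literature.Computability.QuantumComplexity.TidyBlockFn
  Literature.Computability.QuantumComplexity.QState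
  Literature.Computability.Complexity Literature.LinearAlgebra.Matrix.Berkowitz Peikert2009 Finset _root_.Matrix SamplerArith
  SamplerScale SamplerGeom SamplerWords SamplerWordFns SamplerFormats SamplerQuery CVPOracle SamplerClassical
  SamplerClassical.Layout SamplerSubst SamplerDecode _root_.Computability Module
open scoped Real

variable {W : ℕ} (I : LatticeInstance) (Λ : Layout W I.n)

/-! ### The size data of the box -/

/-- **`Y = t R⁻¹ Σᵢ ‖b∨ᵢ‖`** (`R = 2^{ℓ_R}`): the bound on the branch points `‖y(x)‖`. [cite: Regev2009, Lemma 3.12 (proof)] -/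
def Ysz [IsZLattice ℝ I.lattice] (t : ℝ) : ℝ := t * ((2 ^ Λ.ℓR : ℕ) : ℝ)⁻¹ * ∑ i, ‖Peikert2009.dualVec I i‖

/-- **`B = √n 2^ℓ/D_t + Y`**: the bound on `‖x − y(x')‖` over the box. [folklore] -/
def Bsz [IsZLattice ℝ I.lattice] (t : ℝ) : ℝ := Real.sqrt I.n * (2 ^ Λ.ℓ / DT I (2 ^ Λ.ℓR) t) + Ysz I Λ t

variable {Λ} (hΛ : Λ.OK)

/-! ### The decoder and the Gaussian stage's output -/

/-- **The decoder hypothesis for `L_t`**: under `2|t|√n‖b∨ⱼ‖ ≤ R`, `SamplerDecode.dec` returns the short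
point of the coset named by the frequency (the `hdec` of `QPart.law_bound_of_basis` with `bL = t⁻¹ b`).
[cite: Regev2009, Lemma 3.14 (proof: "λ₁(RL) > √n")] -/
theorem dec_scaledL [IsZLattice ℝ I.lattice] {t : ℝ} (ht : 0 < t) (R : ℕ) [NeZero R]
    (hRdec : ∀ j, 2 * |t| * Real.sqrt (finrank ℝ (EuclideanSpace ℝ (Fin I.n))) * ‖Peikert2009.dualVec I j‖ ≤ (R : ℝ)) :
    ∀ w : Fin I.n → ZMod R, ∀ x ∈ scaledL I t ht.ne',
      ‖∑ j, ((w j).val : ℝ) • ((scaledZBasis I t ht.ne' j : scaledL I t ht.ne') : EuclideanSpace ℝ (Fin I.n)) + (R : ℝ) • x‖ <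
          Real.sqrt (finrank ℝ (EuclideanSpace ℝ (Fin I.n))) →
        dec I t R w = ∑ j, ((w j).val : ℝ) • ((scaledZBasis I t ht.ne' j : scaledL I t ht.ne') : EuclideanSpace ℝ (Fin I.n)) + (R : ℝ) • x := by
  intro w x hx hv
  simp only [coe_scaledZBasis] at hv ⊢
  exact dec_eq_of_norm_lt I ht.ne' hRdec w ((mem_scaledL_iff I t ht.ne' x).1 hx) hv

include hΛ in
/-- **The Gaussian stage's output is a unit vector.** [folklore] -/
theorem l2Norm_grState {B : ℕ} {kit : GadgetKit B} {ws : Fin Λ.ℓ ↪ Fin B} {np : ℕ} {pw : Fin np ↪ Fin B}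
    {ag : Fin Λ.ℓ → (Fin Λ.ℓ → Bool) → ℝ} (D : GRBlock.Data kit ws pw ag) (E : Fin I.n → (Fin B ↪ Fin W))
    (L : List (Fin W)) (Ag : Language Bool) (z : QReg W) :
    l2Norm ((notLayer L).toMatrix Ag *ᵥ ((GRStage.stageCircuit D E).toMatrix 0 *ᵥ basisState z)) = 1 := by
  have _ := hΛ
  rw [l2Norm_mulVec_of_mem_unitaryGroup (notLayer_mem_unitaryGroup Ag L),
    l2Norm_mulVec_of_mem_unitaryGroup (QCircuit.toMatrix_mem_unitaryGroup_holds cliffordT_isUnitary_holds 0 _),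
    GRStage.l2Norm_basisState']

/-! ### The measured law of the machine -/

include hΛ in
open Classical in
/-- **Regev 2009, Lemma 3.14 — the measured law of the explicit sampler machine.** For the machine
`M_F · stageMat(T_E(R)) · N_L · GR` on the layout `Λ` started on the prepared basis state (input zone = THE
prefix of `(I, r, k, y, ℓ_R, b_c)` and the parameters, block wires holding the Grover–Rudolph base content
`x₀`), with `R` any `CVP` circuit family placed on a zone in the work window: for every event `A`,

  `|Pr[dec(readS z) ∈ A] − D_{L_t,1/√2}(A)| ≤ 2(ε₁ + 4√(wf + (2C)²) + ε_F + 8C) + 2(√(2(δ_Y + c_Bⁿ + 4⁻ⁿ)) + 2·2⁻ⁿ) + 9·2⁻ⁿ`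

with `ε₁ = n(ℓ·grErr k + η)`, `ε_F = n ℓ_R² qftPhaseErr k_F`, `δ_Y = π(2√n Y + Y²)`, and `wf` the failure of
`R` at distance `√n/t` averaged over the Gaussian weights of the box (`weightedFail` of the data `cOf`).
[cite: Regev2009, Lemma 3.14 (proof), Lemma 3.3 (proof), Lemma 3.12, Claim 2.9]
[cite: BennettBernsteinBrassardVazirani1997, Thm. 3.3, Thm. 4.14] [cite: GroverRudolph2002, eq. (1)] [cite: NielsenChuang2010, §5.1, Box 4.1] -/
theorem law_bound_machine [IsZLattice ℝ I.lattice] [NeZero I.n] (hF : Fits Λ) {t : ℝ} (ht : 0 < t)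
    (hℓ1 : 1 ≤ Λ.ℓ) (hℓY : 1 ≤ Λ.ℓY) (hbc : 1 ≤ Λ.bc) (hbcR : Λ.bc ≤ Λ.ℓR)
    -- Regev's parameter conditions
    (hd : Real.sqrt I.n / t ≤ minNorm (dualLattice I.lattice) / 2)
    (hd2 : 2 * Real.sqrt (finrank ℝ (EuclideanSpace ℝ (Fin I.n))) ≤ t * minNorm (dualLattice I.lattice))
    (hRmin : 2 * Real.sqrt (finrank ℝ (EuclideanSpace ℝ (Fin I.n))) * t ≤ (2 ^ Λ.ℓR : ℕ) * minNorm I.lattice)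
    (hRdec : ∀ j, 2 * |t| * Real.sqrt (finrank ℝ (EuclideanSpace ℝ (Fin I.n))) * ‖Peikert2009.dualVec I j‖ ≤ ((2 ^ Λ.ℓR : ℕ) : ℝ))
    (hfit : DT I (2 ^ Λ.ℓR) t * (Real.sqrt I.n + Ysz I Λ t) + 1 ≤ (2 : ℝ) ^ (Λ.ℓ - 1))
    {C : ℝ} (hδ : π * (2 * Real.sqrt (finrank ℝ (EuclideanSpace ℝ (Fin I.n))) * Ysz I Λ t + Ysz I Λ t ^ 2) < 1)
    (hC : Real.exp (2 * π * Bsz I Λ t * Ysz I Λ t) * (2⁻¹ : ℝ) ^ finrank ℝ (EuclideanSpace ℝ (Fin I.n)) ≤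
      C * ((1 - π * (2 * Real.sqrt (finrank ℝ (EuclideanSpace ℝ (Fin I.n))) * Ysz I Λ t + Ysz I Λ t ^ 2)) *
        (1 - banaConst ^ finrank ℝ (EuclideanSpace ℝ (Fin I.n))) * (1 - (4⁻¹ : ℝ) ^ finrank ℝ (EuclideanSpace ℝ (Fin I.n)))))
    (hC2 : C ≤ 1 / 2) (hC0 : 0 ≤ C)
    -- the input zone
    (r : ℚ) (k : ℕ) (y : List Bool) (e : ℚ) (Fq pad : List Bool)
    (hFq0 : Fq = boolPair (boolPair (stageInput (GapSVPInstance.encode (I, r)) (k + 1) y) (boolPair (encodeNat Λ.ℓR) (encodeNat Λ.bc))) [])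
    (hFq : Fq.length = Λ.Lq) (huz : (zoneOf Fq ((parOf I, 2 ^ Λ.ℓR), e) pad).length = Λ.L)
    (hyr : ∀ (Yb : Fin I.n → Fin Λ.ℓ → Bool) i, -2 ^ (Λ.ℓY - 1) ≤ ytil I (gridVec I Yb) i ∧ ytil I (gridVec I Yb) i < 2 ^ (Λ.ℓY - 1))
    (hmr : ∀ (Yb : Fin I.n → Fin Λ.ℓ → Bool), GoodT I (2 ^ Λ.ℓR) t ht.ne' (boxPt (DT I (2 ^ Λ.ℓR) t) Yb) →
      ∀ i, -2 ^ (Λ.bc - 1) ≤ -mVec I (2 ^ Λ.ℓR) (gridVec I Yb) i ∧ -mVec I (2 ^ Λ.ℓR) (gridVec I Yb) i < 2 ^ (Λ.bc - 1))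
    -- the `CVP` family and its zone
    (Rf : UniformQCircuitFamily) (Z : SubZone Λ (Rf.family.ancillas Λ.kq)) (hZ : ∀ s, Λ.base ≤ (Z.dirt s : ℕ))
    -- the Grover–Rudolph stage
    {B : ℕ} {kit : GadgetKit B} {ws : Fin Λ.ℓ ↪ Fin B} {np : ℕ} {pw : Fin np ↪ Fin B} {ag : Fin Λ.ℓ → (Fin Λ.ℓ → Bool) → ℝ}
    (D : GRBlock.Data kit ws pw ag) {E : Fin I.n → (Fin B ↪ Fin W)} (hE : BlocksFit I Λ E ws)
    (x₀ : QReg B) (hx₀ : x₀ ∈ D.P) (x₁ : QReg B) (hx₁ : ∀ q, q ∉ Set.range ws → x₁ q = false)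
    (Lr : List (Fin W)) (hLnd : Lr.Nodup) (hL : ∀ w, w ∈ Lr ↔ ∃ i q, q ∉ Set.range ws ∧ x₀ q ≠ x₁ q ∧ E i q = w)
    (x' : EuclideanSpace ℝ (Fin I.n)) {c : ℝ} (hc : c = 2 * π / DT I (2 ^ Λ.ℓR) t ^ 2) (Ag : Language Bool) {η : ℝ}
    (hη : l2Norm ((List.ofFn fun j => genLevelGate ws (GRBlock.R ag) j).reverse.prod *ᵥ basisState x₀ - ptQsample Λ.ℓ c ws x₀) ≤ η)
    -- the Fourier stage
    (kF : ℕ) (hk : 1 ≤ kF) (hroom : Λ.base + I.n * QFTKit.qbsize Λ.ℓR kF ≤ W)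
    (A : Set (EuclideanSpace ℝ (Fin I.n))) :
    |∑ z ∈ univ.filter (fun z => dec I t (2 ^ Λ.ℓR) (readS (Sblk I hΛ) z) ∈ A),
        ‖((QFTStage.stageCircuit (qftBlock I hΛ kF hroom) hk).toMatrix 0 *ᵥ
          (stageMat hΛ hF (placeGate (subE hΛ Z) (tidyCirc (Rf.family.circ Λ.kq)).mat) *ᵥ
            ((notLayer Lr).toMatrix Ag *ᵥ ((GRStage.stageCircuit D E).toMatrix 0 *ᵥ
              basisState (boxLab E ws x₀ (lab₀ I Λ (2 ^ Λ.ℓR) t (zoneOf Fq ((parOf I, 2 ^ Λ.ℓR), e) pad) x') fun _ => x₀ ∘ ws))))) z‖ ^ 2 -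
        ((discreteGaussian (scaledL I t ht.ne') (Real.sqrt 2)⁻¹ 0).toOuterMeasure
          {x : scaledL I t ht.ne' | (x : EuclideanSpace ℝ (Fin I.n)) ∈ A}).toReal| ≤
      2 * (I.n * (Λ.ℓ * grErr kit.k + η) +
            4 * Real.sqrt ((weightedFail Rf I r k y (Real.sqrt I.n / t)
              (dataLaw (boxSet I.n Λ.ℓ (DT I (2 ^ Λ.ℓR) t))
                (fun x => (gaussianFunction 1 x / zBox (boxSet I.n Λ.ℓ (DT I (2 ^ Λ.ℓR) t))) ^ 2) (fun _ _ => sq_nonneg _)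
                (sum_boxWeight_eq_one (boxSet_nonempty I.n Λ.ℓ (DT I (2 ^ Λ.ℓR) t))) (cOf I Λ t))).toReal + (2 * C) ^ 2) +
            I.n * (Λ.ℓR * Λ.ℓR * qftPhaseErr kF) + 8 * C) +
        2 * (Real.sqrt (2 * (π * (2 * Real.sqrt (finrank ℝ (EuclideanSpace ℝ (Fin I.n))) * Ysz I Λ t + Ysz I Λ t ^ 2) +
              banaConst ^ finrank ℝ (EuclideanSpace ℝ (Fin I.n)) + 4⁻¹ ^ finrank ℝ (EuclideanSpace ℝ (Fin I.n)))) +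
          2 * (2⁻¹ : ℝ) ^ finrank ℝ (EuclideanSpace ℝ (Fin I.n))) + 9 * (2⁻¹ : ℝ) ^ finrank ℝ (EuclideanSpace ℝ (Fin I.n)) := by
  haveI : Nontrivial (EuclideanSpace ℝ (Fin I.n)) :=
    Module.nontrivial_of_finrank_pos (R := ℝ) (by rw [finrank_euclideanSpace_fin]; exact Nat.pos_of_ne_zero (NeZero.ne I.n))
  exact law_bound_sampler_of_short hΛ hF Rf Z I r k y (Real.sqrt I.n / t) (scaledL I t ht.ne') (scaledZBasis I t ht.ne')
    (fibreHyps_T I (2 ^ Λ.ℓR) t ht.ne' Λ.ℓ (eq_zero_of_mem_scaledLattice_dualOver_scaledL I ht (2 ^ Λ.ℓR) hd2))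
    (regHyps I hΛ hF ht hℓY hbc hd r k y e Fq pad hFq0 hFq huz hyr hmr) (boxSet_nonempty I.n Λ.ℓ (DT I (2 ^ Λ.ℓR) t))
    (fun x _ s => lab₀_dirt I hΛ (2 ^ Λ.ℓR) t _ Z.dirt hZ x s) (cOf I Λ t)
    (fun x hx => ofFn_qry_kappa_lab₀_of_mem I hΛ hF ht r k y e Fq pad hFq0 hFq huz _ x hx)
    (fun x _ => inRange_cOf I Λ t x) (fun x _ => le_length_answerTable_cOf I Λ t x)
    (fun x hx hg => admissible_cOf I Λ ht hbcR hx hg)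
    (eq_zero_of_mem_scaledLattice_dualOver_scaledL I ht (2 ^ Λ.ℓR) hd2)
    (eq_zero_of_mem_scaledL_of_norm_smul_lt I ht (2 ^ Λ.ℓR) hRmin)
    (dec_scaledL I ht (2 ^ Λ.ℓR) hRdec)
    (B := Bsz I Λ t) (Y := Ysz I Λ t)
    (fun x hx => boxCoversShort_T I (2 ^ Λ.ℓR) ht hℓ1 (le_of_eq (by rw [sum_norm_bRT, abs_of_pos ht]; rfl)) hfit hx)
    (fun x _ => norm_yOfB_le_T I (2 ^ Λ.ℓR) ht x) (fun x hx x' _ => norm_sub_yOfB_le_T I (2 ^ Λ.ℓR) ht hx x')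
    hδ hC hC2 hC0 (l2Norm_grState I hΛ D E Lr Ag _)
    (l2Norm_notLayer_grStage_sub_embed_le I hΛ (2 ^ Λ.ℓR) _ D hE x₀ hx₀ x₁ hx₁ Lr hLnd hL ht x' hc Ag hη)
    (qftStage_mem_unitaryGroup I hΛ kF hroom hk) (qftStage_implOn_Sblk I hΛ kF hroom hk)
    (fun x hx => by
      obtain ⟨Yb, -, rfl⟩ := mem_image.1 hx
      exact kappa_lab₀_mem_P_qftBlock I hΛ kF hroom hF hk ht r k y e Fq pad hFq huz Yb) A

/-! ### The law of the integer output -/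

omit hΛ in
/-- **The Born law of a unit vector on an event is the filtered sum of the squared amplitudes.**
[cite: NielsenChuang2010, §2.2.5] -/
theorem toReal_bornPMF_setOf {v : QReg W → ℂ} (hv : l2Norm v = 1) (p : QReg W → Prop) [DecidablePred p] :
    ((bornPMF v).toOuterMeasure {z | p z}).toReal = ∑ z ∈ univ.filter p, ‖v z‖ ^ 2 := by
  have hn : Cryptography.normSq v = 1 := by rw [← l2Norm_sq, hv, one_pow]
  have happ : ∀ z, bornPMF v z = ENNReal.ofReal (‖v z‖ ^ 2) := bornPMF_apply_of_sum_eq_one hn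
  rw [PMF.toOuterMeasure_apply, tsum_fintype, ENNReal.toReal_sum (fun z _ => ?_), Finset.sum_filter]
  · refine Finset.sum_congr rfl fun z _ => ?_
    simp only [Set.indicator, Set.mem_setOf_eq]
    split_ifs
    · rw [happ, ENNReal.toReal_ofReal (sq_nonneg _)]
    · rfl
  · simp only [Set.indicator, Set.mem_setOf_eq]
    split_ifs
    · rw [happ]; exact ENNReal.ofReal_ne_top
    · exact ENNReal.zero_ne_top

include hΛ in
open Classical in
/-- **Regev 2009, Lemma 3.14 — the law of the sampler machine's integer output.** Measuring all wires of
the machine's final state, reading the residue blocks and decoding (`decZ ∘ readS`) gives an integer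
vector whose law is within the bound of `law_bound_machine` of `intCoords_* D_{L(B), t/√2}` in
statistical distance — with `t = √n/d`, `d = αq/(√2 r)`, this is `D_{L, r√n/(αq)}` read in coordinates,
the middle clause of `regev2009_lemma_3_14_stepFamily` for the bare machine.
[cite: Regev2009, Lemma 3.14 (statement and proof), Claim 2.9] [cite: NielsenChuang2010, §2.2.5] -/
theorem tvDist_machine [IsZLattice ℝ I.lattice] [NeZero I.n] (hF : Fits Λ) {t : ℝ} (ht : 0 < t)
    (hℓ1 : 1 ≤ Λ.ℓ) (hℓY : 1 ≤ Λ.ℓY) (hbc : 1 ≤ Λ.bc) (hbcR : Λ.bc ≤ Λ.ℓR)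
    (hd : Real.sqrt I.n / t ≤ minNorm (dualLattice I.lattice) / 2)
    (hd2 : 2 * Real.sqrt (finrank ℝ (EuclideanSpace ℝ (Fin I.n))) ≤ t * minNorm (dualLattice I.lattice))
    (hRmin : 2 * Real.sqrt (finrank ℝ (EuclideanSpace ℝ (Fin I.n))) * t ≤ (2 ^ Λ.ℓR : ℕ) * minNorm I.lattice)
    (hRdec : ∀ j, 2 * |t| * Real.sqrt (finrank ℝ (EuclideanSpace ℝ (Fin I.n))) * ‖Peikert2009.dualVec I j‖ ≤ ((2 ^ Λ.ℓR : ℕ) : ℝ))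
    (hfit : DT I (2 ^ Λ.ℓR) t * (Real.sqrt I.n + Ysz I Λ t) + 1 ≤ (2 : ℝ) ^ (Λ.ℓ - 1))
    {C : ℝ} (hδ : π * (2 * Real.sqrt (finrank ℝ (EuclideanSpace ℝ (Fin I.n))) * Ysz I Λ t + Ysz I Λ t ^ 2) < 1)
    (hC : Real.exp (2 * π * Bsz I Λ t * Ysz I Λ t) * (2⁻¹ : ℝ) ^ finrank ℝ (EuclideanSpace ℝ (Fin I.n)) ≤
      C * ((1 - π * (2 * Real.sqrt (finrank ℝ (EuclideanSpace ℝ (Fin I.n))) * Ysz I Λ t + Ysz I Λ t ^ 2)) *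
        (1 - banaConst ^ finrank ℝ (EuclideanSpace ℝ (Fin I.n))) * (1 - (4⁻¹ : ℝ) ^ finrank ℝ (EuclideanSpace ℝ (Fin I.n)))))
    (hC2 : C ≤ 1 / 2) (hC0 : 0 ≤ C)
    (r : ℚ) (k : ℕ) (y : List Bool) (e : ℚ) (Fq pad : List Bool)
    (hFq0 : Fq = boolPair (boolPair (stageInput (GapSVPInstance.encode (I, r)) (k + 1) y) (boolPair (encodeNat Λ.ℓR) (encodeNat Λ.bc))) [])
    (hFq : Fq.length = Λ.Lq) (huz : (zoneOf Fq ((parOf I, 2 ^ Λ.ℓR), e) pad).length = Λ.L)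
    (hyr : ∀ (Yb : Fin I.n → Fin Λ.ℓ → Bool) i, -2 ^ (Λ.ℓY - 1) ≤ ytil I (gridVec I Yb) i ∧ ytil I (gridVec I Yb) i < 2 ^ (Λ.ℓY - 1))
    (hmr : ∀ (Yb : Fin I.n → Fin Λ.ℓ → Bool), GoodT I (2 ^ Λ.ℓR) t ht.ne' (boxPt (DT I (2 ^ Λ.ℓR) t) Yb) →
      ∀ i, -2 ^ (Λ.bc - 1) ≤ -mVec I (2 ^ Λ.ℓR) (gridVec I Yb) i ∧ -mVec I (2 ^ Λ.ℓR) (gridVec I Yb) i < 2 ^ (Λ.bc - 1))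
    (Rf : UniformQCircuitFamily) (Z : SubZone Λ (Rf.family.ancillas Λ.kq)) (hZ : ∀ s, Λ.base ≤ (Z.dirt s : ℕ))
    {B : ℕ} {kit : GadgetKit B} {ws : Fin Λ.ℓ ↪ Fin B} {np : ℕ} {pw : Fin np ↪ Fin B} {ag : Fin Λ.ℓ → (Fin Λ.ℓ → Bool) → ℝ}
    (D : GRBlock.Data kit ws pw ag) {E : Fin I.n → (Fin B ↪ Fin W)} (hE : BlocksFit I Λ E ws)
    (x₀ : QReg B) (hx₀ : x₀ ∈ D.P) (x₁ : QReg B) (hx₁ : ∀ q, q ∉ Set.range ws → x₁ q = false)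
    (Lr : List (Fin W)) (hLnd : Lr.Nodup) (hL : ∀ w, w ∈ Lr ↔ ∃ i q, q ∉ Set.range ws ∧ x₀ q ≠ x₁ q ∧ E i q = w)
    (x' : EuclideanSpace ℝ (Fin I.n)) {c : ℝ} (hc : c = 2 * π / DT I (2 ^ Λ.ℓR) t ^ 2) (Ag : Language Bool) {η : ℝ}
    (hη : l2Norm ((List.ofFn fun j => genLevelGate ws (GRBlock.R ag) j).reverse.prod *ᵥ basisState x₀ - ptQsample Λ.ℓ c ws x₀) ≤ η)
    (kF : ℕ) (hk : 1 ≤ kF) (hroom : Λ.base + I.n * QFTKit.qbsize Λ.ℓR kF ≤ W) :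
    ((bornPMF ((QFTStage.stageCircuit (qftBlock I hΛ kF hroom) hk).toMatrix 0 *ᵥ
          (stageMat hΛ hF (placeGate (subE hΛ Z) (tidyCirc (Rf.family.circ Λ.kq)).mat) *ᵥ
            ((notLayer Lr).toMatrix Ag *ᵥ ((GRStage.stageCircuit D E).toMatrix 0 *ᵥ
              basisState (boxLab E ws x₀ (lab₀ I Λ (2 ^ Λ.ℓR) t (zoneOf Fq ((parOf I, 2 ^ Λ.ℓR), e) pad) x') fun _ => x₀ ∘ ws)))))).map
        fun z => decZ I (2 ^ Λ.ℓR) (readS (Sblk I hΛ) z)).tvDist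
      ((discreteGaussian I.lattice (t / Real.sqrt 2) 0).map I.intCoords) ≤
      2 * (I.n * (Λ.ℓ * grErr kit.k + η) +
            4 * Real.sqrt ((weightedFail Rf I r k y (Real.sqrt I.n / t)
              (dataLaw (boxSet I.n Λ.ℓ (DT I (2 ^ Λ.ℓR) t))
                (fun x => (gaussianFunction 1 x / zBox (boxSet I.n Λ.ℓ (DT I (2 ^ Λ.ℓR) t))) ^ 2) (fun _ _ => sq_nonneg _)
                (sum_boxWeight_eq_one (boxSet_nonempty I.n Λ.ℓ (DT I (2 ^ Λ.ℓR) t))) (cOf I Λ t))).toReal + (2 * C) ^ 2) +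
            I.n * (Λ.ℓR * Λ.ℓR * qftPhaseErr kF) + 8 * C) +
        2 * (Real.sqrt (2 * (π * (2 * Real.sqrt (finrank ℝ (EuclideanSpace ℝ (Fin I.n))) * Ysz I Λ t + Ysz I Λ t ^ 2) +
              banaConst ^ finrank ℝ (EuclideanSpace ℝ (Fin I.n)) + 4⁻¹ ^ finrank ℝ (EuclideanSpace ℝ (Fin I.n)))) +
          2 * (2⁻¹ : ℝ) ^ finrank ℝ (EuclideanSpace ℝ (Fin I.n))) + 9 * (2⁻¹ : ℝ) ^ finrank ℝ (EuclideanSpace ℝ (Fin I.n)) := by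
  refine tvDist_map_decZ_le I (2 ^ Λ.ℓR) _ (fun z => readS (Sblk I hΛ) z) ht fun A => ?_
  have hψ : l2Norm ((QFTStage.stageCircuit (qftBlock I hΛ kF hroom) hk).toMatrix 0 *ᵥ
      (stageMat hΛ hF (placeGate (subE hΛ Z) (tidyCirc (Rf.family.circ Λ.kq)).mat) *ᵥ
        ((notLayer Lr).toMatrix Ag *ᵥ ((GRStage.stageCircuit D E).toMatrix 0 *ᵥ
          basisState (boxLab E ws x₀ (lab₀ I Λ (2 ^ Λ.ℓR) t (zoneOf Fq ((parOf I, 2 ^ Λ.ℓR), e) pad) x') fun _ => x₀ ∘ ws))))) = 1 := by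
    rw [l2Norm_mulVec_of_mem_unitaryGroup (qftStage_mem_unitaryGroup I hΛ kF hroom hk),
      l2Norm_mulVec_of_mem_unitaryGroup (stageMat_mem_unitaryGroup hΛ hF (placeGate_tidyCirc_mem_unitaryGroup (ℓ := I.n * Λ.bc) (Rf.family.circ Λ.kq) (subE hΛ Z))), l2Norm_grState I hΛ D E Lr Ag]
  rw [toReal_bornPMF_setOf hψ]
  exact law_bound_machine I hΛ hF ht hℓ1 hℓY hbc hbcR hd hd2 hRmin hRdec hfit hδ hC hC2 hC0 r k y e Fq pad hFq0 hFq huz hyr hmr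
    Rf Z hZ D hE x₀ hx₀ x₁ hx₁ Lr hLnd hL x' hc Ag hη kF hk hroom A

/-! ### The machine as one circuit -/

/-- **The sampler machine as one circuit**: the GR stage, the NOT layer writing the GR parameters, the
classical stage with the tidy blocks of the `CVP` subroutine family in both oracle slots, the QFT stage
(gates in time order). [cite: Regev2009, Lemma 3.14 (proof), Lemma 3.3 (proof)] -/
def machineCirc (hF : Fits Λ) (Rf : UniformQCircuitFamily) (Z : SubZone Λ (Rf.family.ancillas Λ.kq))
    {B : ℕ} {kit : GadgetKit B} {ws : Fin Λ.ℓ ↪ Fin B} {np : ℕ} {pw : Fin np ↪ Fin B} {ag : Fin Λ.ℓ → (Fin Λ.ℓ → Bool) → ℝ}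
    (D : GRBlock.Data kit ws pw ag) (E : Fin I.n → (Fin B ↪ Fin W)) (Lr : List (Fin W))
    (kF : ℕ) (hk : 1 ≤ kF) (hroom : Λ.base + I.n * QFTKit.qbsize Λ.ℓR kF ≤ W) : QCircuit cliffordT W :=
  (((GRStage.stageCircuit D E).append (notLayer Lr)).append
      (stageCirc hΛ hF (subE hΛ Z) (tidyCirc (ℓ := I.n * Λ.bc) (Rf.family.circ Λ.kq)))).append
    (QFTStage.stageCircuit (qftBlock I hΛ kF hroom) hk)

/-- **Running the machine circuit** is applying the four stage matrices in turn. [cite: NielsenChuang2010, §4.2] -/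
theorem runOn_machineCirc (hF : Fits Λ) (Rf : UniformQCircuitFamily) (Z : SubZone Λ (Rf.family.ancillas Λ.kq))
    {B : ℕ} {kit : GadgetKit B} {ws : Fin Λ.ℓ ↪ Fin B} {np : ℕ} {pw : Fin np ↪ Fin B} {ag : Fin Λ.ℓ → (Fin Λ.ℓ → Bool) → ℝ}
    (D : GRBlock.Data kit ws pw ag) (E : Fin I.n → (Fin B ↪ Fin W)) (Lr : List (Fin W))
    (kF : ℕ) (hk : 1 ≤ kF) (hroom : Λ.base + I.n * QFTKit.qbsize Λ.ℓR kF ≤ W) (ψ : QReg W → ℂ) :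
    (machineCirc I hΛ hF Rf Z D E Lr kF hk hroom).runOn 0 ψ =
      (QFTStage.stageCircuit (qftBlock I hΛ kF hroom) hk).toMatrix 0 *ᵥ
        (stageMat hΛ hF (placeGate (subE hΛ Z) (tidyCirc (Rf.family.circ Λ.kq)).mat) *ᵥ
          ((notLayer Lr).toMatrix 0 *ᵥ ((GRStage.stageCircuit D E).toMatrix 0 *ᵥ ψ))) := by
  rw [QCircuit.runOn, machineCirc, QCircuit.toMatrix_append, QCircuit.toMatrix_append, QCircuit.toMatrix_append,
    toMatrix_stageCirc, Matrix.mulVec_mulVec, Matrix.mulVec_mulVec, Matrix.mulVec_mulVec, Matrix.mul_assoc, Matrix.mul_assoc]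

open Classical in
/-- **Regev 2009, Lemma 3.14 — the statistical distance of the output of the machine circuit** run on the
prepared basis label: `tvDist_machine` for `machineCirc`. [cite: Regev2009, Lemma 3.14 (proof), Lemma 3.3 (proof), Claim 2.9]
[cite: BennettBernsteinBrassardVazirani1997, Thm. 3.3, Thm. 4.14] [cite: GroverRudolph2002, eq. (1)] [cite: NielsenChuang2010, §5.1, Box 4.1, §4.2] -/
theorem tvDist_machineCirc [IsZLattice ℝ I.lattice] [NeZero I.n] (hF : Fits Λ) {t : ℝ} (ht : 0 < t)
    (hℓ1 : 1 ≤ Λ.ℓ) (hℓY : 1 ≤ Λ.ℓY) (hbc : 1 ≤ Λ.bc) (hbcR : Λ.bc ≤ Λ.ℓR)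
    (hd : Real.sqrt I.n / t ≤ minNorm (dualLattice I.lattice) / 2)
    (hd2 : 2 * Real.sqrt (finrank ℝ (EuclideanSpace ℝ (Fin I.n))) ≤ t * minNorm (dualLattice I.lattice))
    (hRmin : 2 * Real.sqrt (finrank ℝ (EuclideanSpace ℝ (Fin I.n))) * t ≤ (2 ^ Λ.ℓR : ℕ) * minNorm I.lattice)
    (hRdec : ∀ j, 2 * |t| * Real.sqrt (finrank ℝ (EuclideanSpace ℝ (Fin I.n))) * ‖Peikert2009.dualVec I j‖ ≤ ((2 ^ Λ.ℓR : ℕ) : ℝ))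
    (hfit : DT I (2 ^ Λ.ℓR) t * (Real.sqrt I.n + Ysz I Λ t) + 1 ≤ (2 : ℝ) ^ (Λ.ℓ - 1))
    {C : ℝ} (hδ : π * (2 * Real.sqrt (finrank ℝ (EuclideanSpace ℝ (Fin I.n))) * Ysz I Λ t + Ysz I Λ t ^ 2) < 1)
    (hC : Real.exp (2 * π * Bsz I Λ t * Ysz I Λ t) * (2⁻¹ : ℝ) ^ finrank ℝ (EuclideanSpace ℝ (Fin I.n)) ≤
      C * ((1 - π * (2 * Real.sqrt (finrank ℝ (EuclideanSpace ℝ (Fin I.n))) * Ysz I Λ t + Ysz I Λ t ^ 2)) *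
        (1 - banaConst ^ finrank ℝ (EuclideanSpace ℝ (Fin I.n))) * (1 - (4⁻¹ : ℝ) ^ finrank ℝ (EuclideanSpace ℝ (Fin I.n)))))
    (hC2 : C ≤ 1 / 2) (hC0 : 0 ≤ C)
    (r : ℚ) (k : ℕ) (y : List Bool) (e : ℚ) (Fq pad : List Bool)
    (hFq0 : Fq = boolPair (boolPair (stageInput (GapSVPInstance.encode (I, r)) (k + 1) y) (boolPair (encodeNat Λ.ℓR) (encodeNat Λ.bc))) [])
    (hFq : Fq.length = Λ.Lq) (huz : (zoneOf Fq ((parOf I, 2 ^ Λ.ℓR), e) pad).length = Λ.L)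
    (hyr : ∀ (Yb : Fin I.n → Fin Λ.ℓ → Bool) i, -2 ^ (Λ.ℓY - 1) ≤ ytil I (gridVec I Yb) i ∧ ytil I (gridVec I Yb) i < 2 ^ (Λ.ℓY - 1))
    (hmr : ∀ (Yb : Fin I.n → Fin Λ.ℓ → Bool), GoodT I (2 ^ Λ.ℓR) t ht.ne' (boxPt (DT I (2 ^ Λ.ℓR) t) Yb) →
      ∀ i, -2 ^ (Λ.bc - 1) ≤ -mVec I (2 ^ Λ.ℓR) (gridVec I Yb) i ∧ -mVec I (2 ^ Λ.ℓR) (gridVec I Yb) i < 2 ^ (Λ.bc - 1))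
    (Rf : UniformQCircuitFamily) (Z : SubZone Λ (Rf.family.ancillas Λ.kq)) (hZ : ∀ s, Λ.base ≤ (Z.dirt s : ℕ))
    {B : ℕ} {kit : GadgetKit B} {ws : Fin Λ.ℓ ↪ Fin B} {np : ℕ} {pw : Fin np ↪ Fin B} {ag : Fin Λ.ℓ → (Fin Λ.ℓ → Bool) → ℝ}
    (D : GRBlock.Data kit ws pw ag) {E : Fin I.n → (Fin B ↪ Fin W)} (hE : BlocksFit I Λ E ws)
    (x₀ : QReg B) (hx₀ : x₀ ∈ D.P) (x₁ : QReg B) (hx₁ : ∀ q, q ∉ Set.range ws → x₁ q = false)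
    (Lr : List (Fin W)) (hLnd : Lr.Nodup) (hL : ∀ w, w ∈ Lr ↔ ∃ i q, q ∉ Set.range ws ∧ x₀ q ≠ x₁ q ∧ E i q = w)
    (x' : EuclideanSpace ℝ (Fin I.n)) {c : ℝ} (hc : c = 2 * π / DT I (2 ^ Λ.ℓR) t ^ 2) {η : ℝ}
    (hη : l2Norm ((List.ofFn fun j => genLevelGate ws (GRBlock.R ag) j).reverse.prod *ᵥ basisState x₀ - ptQsample Λ.ℓ c ws x₀) ≤ η)
    (kF : ℕ) (hk : 1 ≤ kF) (hroom : Λ.base + I.n * QFTKit.qbsize Λ.ℓR kF ≤ W) :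
    ((bornPMF ((machineCirc I hΛ hF Rf Z D E Lr kF hk hroom).runOn 0
          (basisState (boxLab E ws x₀ (lab₀ I Λ (2 ^ Λ.ℓR) t (zoneOf Fq ((parOf I, 2 ^ Λ.ℓR), e) pad) x') fun _ => x₀ ∘ ws)))).map
        fun z => decZ I (2 ^ Λ.ℓR) (readS (Sblk I hΛ) z)).tvDist
      ((discreteGaussian I.lattice (t / Real.sqrt 2) 0).map I.intCoords) ≤
      2 * (I.n * (Λ.ℓ * grErr kit.k + η) +
            4 * Real.sqrt ((weightedFail Rf I r k y (Real.sqrt I.n / t)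
              (dataLaw (boxSet I.n Λ.ℓ (DT I (2 ^ Λ.ℓR) t))
                (fun x => (gaussianFunction 1 x / zBox (boxSet I.n Λ.ℓ (DT I (2 ^ Λ.ℓR) t))) ^ 2) (fun _ _ => sq_nonneg _)
                (sum_boxWeight_eq_one (boxSet_nonempty I.n Λ.ℓ (DT I (2 ^ Λ.ℓR) t))) (cOf I Λ t))).toReal + (2 * C) ^ 2) +
            I.n * (Λ.ℓR * Λ.ℓR * qftPhaseErr kF) + 8 * C) +
        2 * (Real.sqrt (2 * (π * (2 * Real.sqrt (finrank ℝ (EuclideanSpace ℝ (Fin I.n))) * Ysz I Λ t + Ysz I Λ t ^ 2) +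
              banaConst ^ finrank ℝ (EuclideanSpace ℝ (Fin I.n)) + 4⁻¹ ^ finrank ℝ (EuclideanSpace ℝ (Fin I.n)))) +
          2 * (2⁻¹ : ℝ) ^ finrank ℝ (EuclideanSpace ℝ (Fin I.n))) + 9 * (2⁻¹ : ℝ) ^ finrank ℝ (EuclideanSpace ℝ (Fin I.n)) := by
  rw [runOn_machineCirc]
  exact tvDist_machine I hΛ hF ht hℓ1 hℓY hbc hbcR hd hd2 hRmin hRdec hfit hδ hC hC2 hC0 r k y e Fq pad hFq0 hFq huz hyr hmr
    Rf Z hZ D hE x₀ hx₀ x₁ hx₁ Lr hLnd hL x' hc 0 hη kF hk hroom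

/-! ### The bound in the shape `8·√(weighted failure) + slack` -/

/-- **The slack of the machine bound**: everything except the subroutine's weighted failure —
`2n(ℓ·grErr k + η) + 2n ℓ_R² qftPhaseErr k_F + 32C + 2(√(2(π(2√n Y + Y²) + bana^n + 4^{-n})) + 2·2^{-n}) + 9·2^{-n}`.
[cite: Regev2009, Lemma 3.14 (proof)] -/
def slack (n ℓ ℓR kk kF : ℕ) (Y C η : ℝ) : ℝ :=
  2 * (n * (ℓ * grErr kk + η)) + 2 * (n * (ℓR * ℓR * qftPhaseErr kF)) + 32 * C +
    (2 * (Real.sqrt (2 * (π * (2 * Real.sqrt n * Y + Y ^ 2) + banaConst ^ n + (4⁻¹ : ℝ) ^ n)) + 2 * (2⁻¹ : ℝ) ^ n) +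
      9 * (2⁻¹ : ℝ) ^ n)

open Classical in
/-- **Regev 2009, Lemma 3.14 — the output law of the machine circuit is within
`8·√(weighted failure of the CVP family) + slack` of `intCoords_* D_{L(B), t/√2}`** (the shape of the middle
clause of `regev2009_lemma_3_14_stepFamily`: constant `8`, the slack to be shown negligible in `n` for the
chosen parameters). [cite: Regev2009, Lemma 3.14 (proof), Lemma 3.3 (proof), Claim 2.9]
[cite: BennettBernsteinBrassardVazirani1997, Thm. 3.3, Thm. 4.14] -/
theorem tvDist_machineCirc_le [IsZLattice ℝ I.lattice] [NeZero I.n] (hF : Fits Λ) {t : ℝ} (ht : 0 < t)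
    (hℓ1 : 1 ≤ Λ.ℓ) (hℓY : 1 ≤ Λ.ℓY) (hbc : 1 ≤ Λ.bc) (hbcR : Λ.bc ≤ Λ.ℓR)
    (hd : Real.sqrt I.n / t ≤ minNorm (dualLattice I.lattice) / 2)
    (hd2 : 2 * Real.sqrt (finrank ℝ (EuclideanSpace ℝ (Fin I.n))) ≤ t * minNorm (dualLattice I.lattice))
    (hRmin : 2 * Real.sqrt (finrank ℝ (EuclideanSpace ℝ (Fin I.n))) * t ≤ (2 ^ Λ.ℓR : ℕ) * minNorm I.lattice)
    (hRdec : ∀ j, 2 * |t| * Real.sqrt (finrank ℝ (EuclideanSpace ℝ (Fin I.n))) * ‖Peikert2009.dualVec I j‖ ≤ ((2 ^ Λ.ℓR : ℕ) : ℝ))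
    (hfit : DT I (2 ^ Λ.ℓR) t * (Real.sqrt I.n + Ysz I Λ t) + 1 ≤ (2 : ℝ) ^ (Λ.ℓ - 1))
    {C : ℝ} (hδ : π * (2 * Real.sqrt (finrank ℝ (EuclideanSpace ℝ (Fin I.n))) * Ysz I Λ t + Ysz I Λ t ^ 2) < 1)
    (hC : Real.exp (2 * π * Bsz I Λ t * Ysz I Λ t) * (2⁻¹ : ℝ) ^ finrank ℝ (EuclideanSpace ℝ (Fin I.n)) ≤
      C * ((1 - π * (2 * Real.sqrt (finrank ℝ (EuclideanSpace ℝ (Fin I.n))) * Ysz I Λ t + Ysz I Λ t ^ 2)) *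
        (1 - banaConst ^ finrank ℝ (EuclideanSpace ℝ (Fin I.n))) * (1 - (4⁻¹ : ℝ) ^ finrank ℝ (EuclideanSpace ℝ (Fin I.n)))))
    (hC2 : C ≤ 1 / 2) (hC0 : 0 ≤ C)
    (r : ℚ) (k : ℕ) (y : List Bool) (e : ℚ) (Fq pad : List Bool)
    (hFq0 : Fq = boolPair (boolPair (stageInput (GapSVPInstance.encode (I, r)) (k + 1) y) (boolPair (encodeNat Λ.ℓR) (encodeNat Λ.bc))) [])
    (hFq : Fq.length = Λ.Lq) (huz : (zoneOf Fq ((parOf I, 2 ^ Λ.ℓR), e) pad).length = Λ.L)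
    (hyr : ∀ (Yb : Fin I.n → Fin Λ.ℓ → Bool) i, -2 ^ (Λ.ℓY - 1) ≤ ytil I (gridVec I Yb) i ∧ ytil I (gridVec I Yb) i < 2 ^ (Λ.ℓY - 1))
    (hmr : ∀ (Yb : Fin I.n → Fin Λ.ℓ → Bool), GoodT I (2 ^ Λ.ℓR) t ht.ne' (boxPt (DT I (2 ^ Λ.ℓR) t) Yb) →
      ∀ i, -2 ^ (Λ.bc - 1) ≤ -mVec I (2 ^ Λ.ℓR) (gridVec I Yb) i ∧ -mVec I (2 ^ Λ.ℓR) (gridVec I Yb) i < 2 ^ (Λ.bc - 1))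
    (Rf : UniformQCircuitFamily) (Z : SubZone Λ (Rf.family.ancillas Λ.kq)) (hZ : ∀ s, Λ.base ≤ (Z.dirt s : ℕ))
    {B : ℕ} {kit : GadgetKit B} {ws : Fin Λ.ℓ ↪ Fin B} {np : ℕ} {pw : Fin np ↪ Fin B} {ag : Fin Λ.ℓ → (Fin Λ.ℓ → Bool) → ℝ}
    (D : GRBlock.Data kit ws pw ag) {E : Fin I.n → (Fin B ↪ Fin W)} (hE : BlocksFit I Λ E ws)
    (x₀ : QReg B) (hx₀ : x₀ ∈ D.P) (x₁ : QReg B) (hx₁ : ∀ q, q ∉ Set.range ws → x₁ q = false)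
    (Lr : List (Fin W)) (hLnd : Lr.Nodup) (hL : ∀ w, w ∈ Lr ↔ ∃ i q, q ∉ Set.range ws ∧ x₀ q ≠ x₁ q ∧ E i q = w)
    (x' : EuclideanSpace ℝ (Fin I.n)) {c : ℝ} (hc : c = 2 * π / DT I (2 ^ Λ.ℓR) t ^ 2) {η : ℝ}
    (hη : l2Norm ((List.ofFn fun j => genLevelGate ws (GRBlock.R ag) j).reverse.prod *ᵥ basisState x₀ - ptQsample Λ.ℓ c ws x₀) ≤ η)
    (kF : ℕ) (hk : 1 ≤ kF) (hroom : Λ.base + I.n * QFTKit.qbsize Λ.ℓR kF ≤ W) :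
    ((bornPMF ((machineCirc I hΛ hF Rf Z D E Lr kF hk hroom).runOn 0
          (basisState (boxLab E ws x₀ (lab₀ I Λ (2 ^ Λ.ℓR) t (zoneOf Fq ((parOf I, 2 ^ Λ.ℓR), e) pad) x') fun _ => x₀ ∘ ws)))).map
        fun z => decZ I (2 ^ Λ.ℓR) (readS (Sblk I hΛ) z)).tvDist
      ((discreteGaussian I.lattice (t / Real.sqrt 2) 0).map I.intCoords) ≤
      8 * Real.sqrt (weightedFail Rf I r k y (Real.sqrt I.n / t)
              (dataLaw (boxSet I.n Λ.ℓ (DT I (2 ^ Λ.ℓR) t))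
                (fun x => (gaussianFunction 1 x / zBox (boxSet I.n Λ.ℓ (DT I (2 ^ Λ.ℓR) t))) ^ 2) (fun _ _ => sq_nonneg _)
                (sum_boxWeight_eq_one (boxSet_nonempty I.n Λ.ℓ (DT I (2 ^ Λ.ℓR) t))) (cOf I Λ t))).toReal +
        slack I.n Λ.ℓ Λ.ℓR kit.k kF (Ysz I Λ t) C η := by
  have h := tvDist_machineCirc I hΛ hF ht hℓ1 hℓY hbc hbcR hd hd2 hRmin hRdec hfit hδ hC hC2 hC0 r k y e Fq pad hFq0 hFq huz hyr hmr
    Rf Z hZ D hE x₀ hx₀ x₁ hx₁ Lr hLnd hL x' hc hη kF hk hroom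
  rw [finrank_euclideanSpace_fin] at h
  have hsq : ∀ {a : ℝ}, 0 ≤ a → Real.sqrt (a + (2 * C) ^ 2) ≤ Real.sqrt a + 2 * C := fun {a} ha =>
    calc Real.sqrt (a + (2 * C) ^ 2) ≤ Real.sqrt ((Real.sqrt a + 2 * C) ^ 2) :=
          Real.sqrt_le_sqrt (by nlinarith [Real.sq_sqrt ha, Real.sqrt_nonneg a])
      _ = Real.sqrt a + 2 * C := Real.sqrt_sq (by positivity)
  have hs := hsq (ENNReal.toReal_nonneg (a := weightedFail Rf I r k y (Real.sqrt I.n / t)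
    (dataLaw (boxSet I.n Λ.ℓ (DT I (2 ^ Λ.ℓR) t))
      (fun x => (gaussianFunction 1 x / zBox (boxSet I.n Λ.ℓ (DT I (2 ^ Λ.ℓR) t))) ^ 2) (fun _ _ => sq_nonneg _)
      (sum_boxWeight_eq_one (boxSet_nonempty I.n Λ.ℓ (DT I (2 ^ Λ.ℓR) t))) (cOf I Λ t))))
  refine h.trans ?_
  unfold slack
  linarith [hs]

/-! ### The machine circuit is oracle-free -/

omit hΛ in
/-- The NOT layer is oracle-free. [folklore] -/
theorem notLayer_isOracleFree (L : List (Fin W)) : (notLayer L).IsOracleFree := revCompile_isOracleFree _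

/-- **The machine circuit is oracle-free** (the `CVP` subroutine family being oracle-free).
[cite: Regev2009, Lemma 3.14 (proof), Lemma 3.3 (proof)] -/
theorem isOracleFree_machineCirc (hF : Fits Λ) (Rf : UniformQCircuitFamily) (Z : SubZone Λ (Rf.family.ancillas Λ.kq))
    {B : ℕ} {kit : GadgetKit B} {ws : Fin Λ.ℓ ↪ Fin B} {np : ℕ} {pw : Fin np ↪ Fin B} {ag : Fin Λ.ℓ → (Fin Λ.ℓ → Bool) → ℝ}
    (D : GRBlock.Data kit ws pw ag) (E : Fin I.n → (Fin B ↪ Fin W)) (Lr : List (Fin W))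
    (kF : ℕ) (hk : 1 ≤ kF) (hroom : Λ.base + I.n * QFTKit.qbsize Λ.ℓR kF ≤ W) :
    (machineCirc I hΛ hF Rf Z D E Lr kF hk hroom).IsOracleFree := by
  intro g hg
  simp only [machineCirc, QCircuit.append, List.mem_append] at hg
  rcases hg with ((hg | hg) | hg) | hg
  · exact GRStage.stageCircuit_isOracleFree D E g hg
  · exact notLayer_isOracleFree Lr g hg
  · exact isOracleFree_stageCirc hΛ hF (subE hΛ Z) (tidyCirc_isOracleFree (Rf.isOracleFree Λ.kq)) g hg
  · exact QFTStage.stageCircuit_isOracleFree _ hk g hg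

end SamplerRegs

end Regev2009

end Literature.Computability.Cryptography

end
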